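import Literature.MathematicalPhysics.QuantumFieldTheory.Balaban1983to89.B9Thm37GlueTorusCovLevelsPoinc

/-!
# `Balaban1983to89.B9Thm37GlueTorusCovLevelsTower` — COMPOSITE LEVELS ARE POINCARÉ LEVELS: the deviation of a
# composite covariant block mean (coarse comb after fine comb, transports the ordered product (3.19)) is
# T_C·(fine deviation) + (coarse deviation at the fine base point), whence an explicit deviation constant for the
# composite level and the coercivity constant σ₃ for the three-level operator with the cover taken over ALL THREE
# levels (MODEL; own lineage pv21; imports `B9Thm37GlueTorusCovLevelsPoinc` only; modifies nothing)

References (bib keys; the tags below cite only these):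
* [B9] = `Balaban1985BackgroundPropagators` — T. Bałaban, *Propagators for lattice gauge theories in a background
  field*, Commun. Math. Phys. 99 (1985) 389–434.
* [B7] = `Balaban1985Averaging` — T. Bałaban, *Averaging operations for lattice gauge theories*, Commun. Math. Phys.
  98 (1985) 17–51 (= reference [5] of [B9]; only NAMED, through `B9Thm37GlueTorusCovComp`).

THE PRINTED LOCI.  NO new «» span in this file; everything printed is only NAMED and is certified in the headers of
modules in the import closure: [B9] (3.16) p. 393 (the quadratic form ⟨A, Q\*aQA⟩ = Σ_{j=0}^{k} a Σ_{b∈Λ_j}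
(L^jη)^{d−2}|(Q_j(U)A)(b)|² — EVERY level j = 0, …, k carries its own region Λ_j; `B9Thm37GlueTorusCovLevels`),
(3.15)/(3.18)–(3.19) p. 393 (the averaging operators Q_j(U) = Q(Ū^{j−1})⋯Q(U) as ordered products,
`B9Thm37GlueTorusCov`, `B9Thm37GlueTorusCovComp`), (3.3) pp. 390–391 (∇_U, `B9Thm37Glue`), (3.23)–(3.24) p. 394
(Δ′_a = Δ_U + Q′\*aQ′), p. 394 (Ω₀Δ′_aΩ₀ and its inverse G′, `B9Thm37GlueTorusInv`), p. 395 *"Assuming some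
regularity of the configuration U it can be easily shown that the operator Δ′_a is positive. This implies
positivity of the operators G′ …"* (`B9Thm37Glue`).  NOTHING printed is asserted as a theorem — every declaration
below is a MODEL definition or a kernel-checked theorem about the component model of the lineage
(`B9Thm37Glue.covD`, `B9Thm37GlueTorusCov.Comb`, `B9Thm37GlueTorusCovComp.mmul`/`gMean`,
`B9Thm37GlueTorusCovLevels.levelOp`/`threeLevelOp`, `B9Thm37GlueTorusCovLevelsPoinc.gdev`/`sigmaL`,
`B9Thm37GlueTorusInv.dirInv`).

THE POINT (value = a MODEL kernel certificate steering the lineage; NOT summit progress).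
`B9Thm37GlueTorusCovLevelsPoinc` proved σ·‖f‖² ≤ ⟨f, (Δ_U + Σ_j a_j·G_jᵀG_j)f⟩ for fields whose support is covered
by POINCARÉ LEVELS (levels with a deviation bound Σ_xΣ_i gdev_j² ≤ P_j·‖∇_U f‖²) and recorded in its honest scope
(ii): "only levels whose deviation is controlled along ONE comb (identity, one-step comb) are Poincaré levels —
composite (j ≥ 2) levels enter the operator with a_j ≥ 0 but contribute nothing to σ".  In print's weight pattern
every site of Ω₀ lies in exactly ONE region B^j(Λ_j), so a site of the level-2 region is covered by level 2 ONLY and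
the imported dischargers (cover over S = {0, 1}) do not apply there.  THIS FILE makes composite levels Poincaré
levels:
 * §1 COMPOSITION OF TWO LEVELS (abstract).  Level A = (blk_A, base_A, T_A) on sites, level C = (blk_C, base_C,
   T_C) on sites; the COMPOSITE level has blocking `cBlk` x ↦ blk_C(base_A(blk_A x)), transport `cTr` x ↦
   T_C(base_A(blk_A x))·T_A(x) (`B9Thm37GlueTorusCovComp.mmul`, the ordered product coarse·fine of (3.19)) and base
   map base_C.  THE IDENTITY **`gdev_compose`** (no hypothesis at all):
       gdev₂ f x i = Σ_m T_C(b x)_{im}·gdev_A f x m + gdev_C f (b x) i,   b x = base_A(blk_A x);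
   for T_C(b x) isometric the site bound `gdev_compose_sq_le` Σ_i gdev₂² ≤ 2Σ_m gdev_A² + 2Σ_i gdev_C(b x)²; and,
   when the fibres of b have at most n_A sites, the summed bound **`sum_gdev_compose_sq_le`**
       Σ_xΣ_i gdev₂² ≤ 2·Σ_xΣ_m gdev_A² + 2·n_A·Σ_yΣ_i gdev_C², hence (`compose_dev_bound`) the composite level is a
   Poincaré level with constant 2·P_A + 2·n_A·P_C.
 * §2 COMB FACTS: `blk_base_blk` (the base point of the block of x lies in that block: blk(base(blk x)) = blk x, by
   induction along the comb path) and the fibre comparison `card_base_blk_fibre_le` (the sites whose block base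
   point is y all lie in the block of y, so fibres of base ∘ blk have ≤ n sites when blocks do).
 * §3 THE THREE-LEVEL FAMILY of `B9Thm37GlueTorusCovLevels` (levels: identity, fine comb K₁, coarse comb K after
   K₁): level 2 IS the composite of §1 (`gdev_lvl_two_eq`, definitional), so **`gdev_lvl_two`** and
   **`lvl_two_dev_sq_le`**: Σ_xΣ_i gdev₂² ≤ (2·D₁n₁/c_min² + 2·n₁·(D n/c_min²))·Σ_b ((∇_U f)(b))² (K₁ of depth ≤ D₁
   with blocks of ≤ n₁ sites, K of depth ≤ D with blocks of ≤ n sites, |c(b)| ≥ c_min > 0, isometric bond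
   matrices) — for EVERY transport.  With the constants `lvlP3` = (0, D₁n₁/c², 2D₁n₁/c² + 2n₁Dn/c²) and S = ALL
   THREE levels: **`coercive_threeLevelOp_all`** σ₃·Σ_p f(p)² ≤ Σ_p f(p)((Δ_U + Σ_l a_l G_lᵀG_l)f)(p) for every f
   each site of whose support has SOME level l ∈ {0, 1, 2} with a_l ≥ a_min and block weight ≥ w_min,
       σ₃ = `sigma3 a_min w_min c_min D₁ n₁ D n` = ((a_min w_min²)⁻¹ + 3·D₁n₁/c_min² + 2·n₁·D n/c_min²)⁻¹ > 0,
   and the ℓ² bounds σ₃⁻¹ for the inverse under a full cover (`inverse_sq_le_threeLevelOp_all`) and for the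
   DIRICHLET inverse under a cover of Ω₀ = {χ = 1} only (`threeLevelDir_sq_le_all`).
 * §4 THE TORUS `UT N`, cube combs of sides M₀ (fine) and M (coarse): σ₃ = `sigmaTorus3 d M₀ M a_min w_min c_min`
   (`B9Thm37GlueTorusCovPoinc.tdepth_le`, `card_block_le` for both combs) — independent of N and of the transport
   (`coercive_threeLevelOp_all_torus`, `inverse_sq_le_threeLevelOp_all_torus`, `threeLevelDir_sq_le_all_torus`).

NOT ASSERTED, NOT MODELLED (honest scope).  (i) As in the import closure: the averaged configurations Ū^i of [B7]
(42)–(43) are NOT constructed; coarse transports are comb holonomies of U itself or free data; no regularity of U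
is used or concluded.  (ii) The constants are the crude comb constants of `B9Thm37GlueTorusCovLevelsPoinc` doubled
at each composition (2P_A + 2n_A P_C), not the O((L^jη)²) of a genuine cube Poincaré inequality, and σ₃ is ONE
global constant (the reciprocal of the SUM of the level constants), not print's scale-dependent local bounds;
print's factors (L^jη)^{d−2}, L^{−jd} are not tracked; only the three-level family is discharged (a k-fold tower
would iterate §1; not done here).  (iii) ℓ² bounds only: no decay of the inverses, nothing of (3.17), Theorems
3.1–3.3, Corollary 3.6, Theorem 3.7 or (1.31)/Proposition 1.1 of [B9]; the capstones of the chain are not re-wired.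
(iv) Component site fields `St × Cp → ℝ`.  Value = MODEL kernel certificate, NOT summit progress; NOT continuum,
NOT Clay, NOT a claim about print.
-/

namespace Literature.MathematicalPhysics.QuantumFieldTheory.Balaban1983to89.B9Thm37GlueTorusCovLevelsTower

open Finset B9Thm37Sum B9Thm37Glue B9Thm37GlueTorusInv B9Thm37GlueTorusCov B9Thm37GlueTorusCovComp
  B9Thm37GlueTorusCovPoinc B9Thm37GlueTorusCovLevels B9Thm37GlueTorusCovLevelsPoinc
open B5TorusCover (UT Ctr ctrU)

noncomputable section

/-! ## §1  Composition of two levels: the deviation identity and the summed bound -/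

section Compose

variable {St BA BC Cp : Type} [Fintype Cp] [DecidableEq Cp]
  (blkA : St → BA) (baseA : BA → St) (TA : St → Cp → Cp → ℝ)
  (blkC : St → BC) (baseC : BC → St) (TC : St → Cp → Cp → ℝ)

/-- MODEL bookkeeping: the blocking map of the COMPOSITE level — the coarse block of the base point of the fine
block of x. [cite: Balaban1985BackgroundPropagators, (3.19) p.393] -/
def cBlk : St → BC := fun x => blkC (baseA (blkA x))

/-- MODEL bookkeeping: the transport of the COMPOSITE level — the ORDERED PRODUCT (coarse at the fine base point)·
(fine at x) of `B9Thm37GlueTorusCovComp.mmul`. [cite: Balaban1985BackgroundPropagators, (3.19) p.393] -/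
def cTr : St → Cp → Cp → ℝ := fun x => mmul (TC (baseA (blkA x))) (TA x)

omit [DecidableEq Cp] in
/-- Unfolding of `cBlk`. [folklore] -/
theorem cBlk_apply (x : St) : cBlk blkA baseA blkC x = blkC (baseA (blkA x)) := rfl

omit [DecidableEq Cp] in
/-- Unfolding of `cTr`. [folklore] -/
theorem cTr_apply (x : St) (i k : Cp) :
    cTr blkA baseA TA TC x i k = ∑ m, TC (baseA (blkA x)) i m * TA x m k := rfl

omit [DecidableEq Cp] in
/-- **THE COMPOSITION IDENTITY (no hypothesis).**  The deviation of the composite level is the coarse transport of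
the fine deviation plus the coarse deviation at the fine base point:
gdev₂ f x i = Σ_m T_C(b x)_{im}·gdev_A f x m + gdev_C f (b x) i, b x = base_A(blk_A x). [folklore] -/
theorem gdev_compose (f : St × Cp → ℝ) (x : St) (i : Cp) :
    gdev (cBlk blkA baseA blkC) (cTr blkA baseA TA TC) baseC f x i =
      (∑ m, TC (baseA (blkA x)) i m * gdev blkA TA baseA f x m) +
        gdev blkC TC baseC f (baseA (blkA x)) i := by
  simp only [gdev, cBlk, cTr, mmul, mul_sub, Finset.sum_sub_distrib, Finset.mul_sum, Finset.sum_mul]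
  rw [Finset.sum_comm]
  simp only [mul_assoc]
  ring

/-- **Site bound.**  For an isometric coarse transport at the fine base point:
Σ_i gdev₂(x,i)² ≤ 2·Σ_m gdev_A(x,m)² + 2·Σ_i gdev_C(b x, i)². [folklore] -/
theorem gdev_compose_sq_le (f : St × Cp → ℝ) (x : St)
    (hTC : ∀ i i', ∑ k, TC (baseA (blkA x)) k i * TC (baseA (blkA x)) k i' = if i = i' then (1 : ℝ) else 0) :
    ∑ i, gdev (cBlk blkA baseA blkC) (cTr blkA baseA TA TC) baseC f x i ^ 2 ≤
      2 * ∑ m, gdev blkA TA baseA f x m ^ 2 + 2 * ∑ i, gdev blkC TC baseC f (baseA (blkA x)) i ^ 2 := by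
  have hrow := sum_sq_orth_apply hTC (fun m => gdev blkA TA baseA f x m)
  calc ∑ i, gdev (cBlk blkA baseA blkC) (cTr blkA baseA TA TC) baseC f x i ^ 2
      = ∑ i, ((∑ m, TC (baseA (blkA x)) i m * gdev blkA TA baseA f x m) +
          gdev blkC TC baseC f (baseA (blkA x)) i) ^ 2 :=
        Finset.sum_congr rfl fun i _ => by rw [gdev_compose]
    _ ≤ ∑ i, (2 * (∑ m, TC (baseA (blkA x)) i m * gdev blkA TA baseA f x m) ^ 2 +
          2 * gdev blkC TC baseC f (baseA (blkA x)) i ^ 2) :=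
        Finset.sum_le_sum fun i _ => by
          nlinarith [sq_nonneg ((∑ m, TC (baseA (blkA x)) i m * gdev blkA TA baseA f x m) -
            gdev blkC TC baseC f (baseA (blkA x)) i)]
    _ = 2 * ∑ m, gdev blkA TA baseA f x m ^ 2 + 2 * ∑ i, gdev blkC TC baseC f (baseA (blkA x)) i ^ 2 := by
        rw [Finset.sum_add_distrib, ← Finset.mul_sum, ← Finset.mul_sum, hrow]

variable [Fintype St] [DecidableEq St]

omit [DecidableEq Cp] in
/-- **Fibre counting.**  If every fibre of b : St → St has at most n sites, then Σ_x g(b x) ≤ n·Σ_y g(y) for g ≥ 0.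
[folklore] -/
theorem sum_comp_le_of_fibre (b : St → St) {n : ℕ} (hn : ∀ y, (univ.filter fun x => b x = y).card ≤ n)
    {g : St → ℝ} (hg : ∀ y, 0 ≤ g y) : ∑ x, g (b x) ≤ n * ∑ y, g y := by
  have h1 : ∀ x, g (b x) = ∑ y, if b x = y then g y else 0 := fun x => by
    rw [Finset.sum_ite_eq]; simp
  calc ∑ x, g (b x) = ∑ x, ∑ y, (if b x = y then g y else 0) := Finset.sum_congr rfl fun x _ => h1 x
    _ = ∑ y, ∑ x, (if b x = y then g y else 0) := Finset.sum_comm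
    _ = ∑ y, ((univ.filter fun x => b x = y).card : ℝ) * g y :=
        Finset.sum_congr rfl fun y _ => by
          rw [Finset.sum_ite, Finset.sum_const_zero, add_zero, Finset.sum_const, nsmul_eq_mul]
    _ ≤ ∑ y, (n : ℝ) * g y :=
        Finset.sum_le_sum fun y _ => mul_le_mul_of_nonneg_right (by exact_mod_cast hn y) (hg y)
    _ = n * ∑ y, g y := by rw [Finset.mul_sum]

/-- **THE SUMMED BOUND.**  Coarse transports isometric at every site, fibres of b = base_A ∘ blk_A of at most n_A
sites: Σ_xΣ_i gdev₂² ≤ 2·Σ_xΣ_m gdev_A² + 2·n_A·Σ_yΣ_i gdev_C². [folklore] -/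
theorem sum_gdev_compose_sq_le
    (hTC : ∀ y i i', ∑ k, TC y k i * TC y k i' = if i = i' then (1 : ℝ) else 0) {nA : ℕ}
    (hn : ∀ y, (univ.filter fun x => baseA (blkA x) = y).card ≤ nA) (f : St × Cp → ℝ) :
    ∑ x, ∑ i, gdev (cBlk blkA baseA blkC) (cTr blkA baseA TA TC) baseC f x i ^ 2 ≤
      2 * ∑ x, ∑ m, gdev blkA TA baseA f x m ^ 2 +
        2 * nA * ∑ y, ∑ i, gdev blkC TC baseC f y i ^ 2 := by
  have hfib := sum_comp_le_of_fibre (fun x => baseA (blkA x)) hn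
    (g := fun y => ∑ i, gdev blkC TC baseC f y i ^ 2) fun y => Finset.sum_nonneg fun i _ => sq_nonneg _
  calc ∑ x, ∑ i, gdev (cBlk blkA baseA blkC) (cTr blkA baseA TA TC) baseC f x i ^ 2
      ≤ ∑ x, (2 * ∑ m, gdev blkA TA baseA f x m ^ 2 +
          2 * ∑ i, gdev blkC TC baseC f (baseA (blkA x)) i ^ 2) :=
        Finset.sum_le_sum fun x _ => gdev_compose_sq_le blkA baseA TA blkC baseC TC f x (hTC _)
    _ = 2 * ∑ x, ∑ m, gdev blkA TA baseA f x m ^ 2 +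
          2 * ∑ x, ∑ i, gdev blkC TC baseC f (baseA (blkA x)) i ^ 2 := by
        rw [Finset.sum_add_distrib, ← Finset.mul_sum, ← Finset.mul_sum]
    _ ≤ 2 * ∑ x, ∑ m, gdev blkA TA baseA f x m ^ 2 +
          2 * nA * ∑ y, ∑ i, gdev blkC TC baseC f y i ^ 2 := by
        rw [mul_assoc]
        exact add_le_add le_rfl (mul_le_mul_of_nonneg_left hfib (by norm_num))

/-- **THE COMPOSITE LEVEL IS A POINCARÉ LEVEL.**  If level A has deviation constant P_A and level C has deviation
constant P_C against the same quantity Y ≥ 0 (in the applications Y = Σ_b ((∇_U f)(b))²), then the composite level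
has deviation constant 2·P_A + 2·n_A·P_C. [folklore] -/
theorem compose_dev_bound
    (hTC : ∀ y i i', ∑ k, TC y k i * TC y k i' = if i = i' then (1 : ℝ) else 0) {nA : ℕ}
    (hn : ∀ y, (univ.filter fun x => baseA (blkA x) = y).card ≤ nA) (f : St × Cp → ℝ) {PA PC Y : ℝ}
    (hA : ∑ x, ∑ m, gdev blkA TA baseA f x m ^ 2 ≤ PA * Y)
    (hC : ∑ y, ∑ i, gdev blkC TC baseC f y i ^ 2 ≤ PC * Y) :
    ∑ x, ∑ i, gdev (cBlk blkA baseA blkC) (cTr blkA baseA TA TC) baseC f x i ^ 2 ≤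
      (2 * PA + 2 * nA * PC) * Y := by
  have h := sum_gdev_compose_sq_le blkA baseA TA blkC baseC TC hTC hn f
  have hnA : (0 : ℝ) ≤ 2 * nA := by positivity
  have h2 : 2 * (nA : ℝ) * ∑ y, ∑ i, gdev blkC TC baseC f y i ^ 2 ≤ 2 * nA * (PC * Y) :=
    mul_le_mul_of_nonneg_left hC hnA
  nlinarith [h, h2, hA]

end Compose

/-! ## §2  Comb facts: the base point of a block lies in the block; fibres of base ∘ blk -/

section CombFacts

variable {St Bd B : Type} {src tgt : Bd → St} (K : Comb src tgt B)

/-- **The base point of the block of x lies in that block**: blk(base(blk x)) = blk x (follow the comb path of x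
down to depth 0, where the site IS the base point of its block, `Comb.eq_base`; the path stays in the block,
`Comb.blk_parent`). [folklore] -/
theorem blk_base_blk (x : St) : K.blk (K.base (K.blk x)) = K.blk x := by
  suffices h : ∀ n x, K.depth x = n → K.blk (K.base (K.blk x)) = K.blk x from h _ x rfl
  intro n
  induction n with
  | zero =>
      intro x hx
      have h0 := K.eq_base x hx
      rw [← h0]
  | succ n ih =>
      intro x hx
      have hx0 : K.depth x ≠ 0 := by omega
      have hp : K.depth (K.parent x) = n := by
        have := K.depth_parent x hx0
        omega
      rw [← K.blk_parent x hx0]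
      exact ih _ hp

variable [Fintype St] [DecidableEq St] [DecidableEq B]

/-- **Fibre comparison**: the sites whose block base point is y all lie in the block of y, so if every block has
at most n sites then every fibre of base ∘ blk has at most n sites. [folklore] -/
theorem card_base_blk_fibre_le {n : ℕ} (hn : ∀ β, (univ.filter fun x => K.blk x = β).card ≤ n) (y : St) :
    (univ.filter fun x => K.base (K.blk x) = y).card ≤ n := by
  refine le_trans (Finset.card_le_card fun x hx => ?_) (hn (K.blk y))
  simp only [Finset.mem_filter, Finset.mem_univ, true_and] at hx ⊢
  rw [← hx, blk_base_blk]

end CombFacts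

/-! ## §3  The three-level family: level 2 is a Poincaré level; coercivity with the cover over all three levels -/

section ThreeLevels

variable {St Bd B₁ B Cp : Type} [Fintype Cp] [DecidableEq Cp] {src tgt : Bd → St} (K₁ : Comb src tgt B₁)
  (K : Comb src tgt B) (Rm : Bd → Cp → Cp → ℝ)

/-- Level 2 of the three-level family IS the composite of §1 of the comb level of K₁ (blk_A = K₁.blk, base_A =
K₁.base, T_A = K₁'s holonomy) with the comb level of K — definitionally. [cite: Balaban1985BackgroundPropagators, (3.19) p.393] -/
theorem gdev_lvl_two_eq (f : St × Cp → ℝ) (x : St) (i : Cp) :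
    gdev (lvlBlk K₁ K 2) (lvlTr K₁ K Rm 2) (fun y => y) f x i =
      gdev (cBlk K₁.blk K₁.base K.blk) (cTr K₁.blk K₁.base (K₁.tr Rm) (K.tr Rm)) K.base f x i := rfl

/-- **The level-2 deviation**: (coarse holonomy at the K₁-base point)·(fine comb deviation at x) + (coarse comb
deviation at the K₁-base point). [folklore] -/
theorem gdev_lvl_two (f : St × Cp → ℝ) (x : St) (i : Cp) :
    gdev (lvlBlk K₁ K 2) (lvlTr K₁ K Rm 2) (fun y => y) f x i =
      (∑ m, K.tr Rm (K₁.base (K₁.blk x)) i m * dev K₁ Rm f x m) + dev K Rm f (K₁.base (K₁.blk x)) i := by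
  rw [gdev_lvl_two_eq, gdev_compose]
  rfl

variable [Fintype St] [DecidableEq St] [Fintype Bd] [Fintype B₁] [DecidableEq B₁] [Fintype B] [DecidableEq B]

/-- **LEVEL 2 IS A POINCARÉ LEVEL.**  Isometric bond matrices, |c(b)| ≥ c_min > 0, K₁ of depth ≤ D₁ with blocks of
≤ n₁ sites, K of depth ≤ D with blocks of ≤ n sites:
Σ_xΣ_i gdev₂(x,i)² ≤ (2·D₁n₁/c_min² + 2·n₁·(D n/c_min²))·Σ_b ((∇_U f)(b))² for EVERY field and EVERY transport.
[folklore] -/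
theorem lvl_two_dev_sq_le (hRm : ∀ b i j, ∑ k, Rm b k i * Rm b k j = if i = j then (1 : ℝ) else 0)
    {c : Bd → ℝ} {cmin : ℝ} (hcmin : 0 < cmin) (hc : ∀ b, cmin ≤ |c b|) {D₁ : ℕ} (hD₁ : ∀ x, K₁.depth x ≤ D₁)
    {n₁ : ℕ} (hn₁ : ∀ β, (univ.filter fun x => K₁.blk x = β).card ≤ n₁) {D : ℕ} (hD : ∀ x, K.depth x ≤ D)
    {n : ℕ} (hn : ∀ β, (univ.filter fun x => K.blk x = β).card ≤ n) (f : St × Cp → ℝ) :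
    ∑ x, ∑ i, gdev (lvlBlk K₁ K 2) (lvlTr K₁ K Rm 2) (fun y => y) f x i ^ 2 ≤
      (2 * ((D₁ : ℝ) * n₁ * (cmin ^ 2)⁻¹) + 2 * n₁ * ((D : ℝ) * n * (cmin ^ 2)⁻¹)) *
        ∑ b, covD src tgt c Rm f b ^ 2 := by
  simp only [gdev_lvl_two_eq]
  exact compose_dev_bound K₁.blk K₁.base (K₁.tr Rm) K.blk K.base (K.tr Rm) (K.tr_orth Rm hRm)
    (card_base_blk_fibre_le K₁ hn₁) f (sum_dev_sq_le K₁ c Rm hRm hcmin hc hD₁ hn₁ f)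
    (sum_dev_sq_le K c Rm hRm hcmin hc hD hn f)

/-- MODEL bookkeeping: the Poincaré constants of ALL THREE levels — 0 (identity), D₁n₁/c_min² (fine comb),
2·D₁n₁/c_min² + 2·n₁·D n/c_min² (coarse comb after fine comb). [folklore] -/
def lvlP3 (cmin : ℝ) (D₁ n₁ D n : ℕ) : Fin 3 → ℝ := fun l =>
  if l = 0 then 0 else if l = 1 then (D₁ : ℝ) * n₁ * (cmin ^ 2)⁻¹
    else 2 * ((D₁ : ℝ) * n₁ * (cmin ^ 2)⁻¹) + 2 * n₁ * ((D : ℝ) * n * (cmin ^ 2)⁻¹)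

/-- The identity level has constant 0. [folklore] -/
theorem lvlP3_zero (cmin : ℝ) (D₁ n₁ D n : ℕ) : lvlP3 cmin D₁ n₁ D n 0 = 0 := if_pos rfl

/-- The fine comb level has constant D₁n₁/c_min². [folklore] -/
theorem lvlP3_one (cmin : ℝ) (D₁ n₁ D n : ℕ) : lvlP3 cmin D₁ n₁ D n 1 = (D₁ : ℝ) * n₁ * (cmin ^ 2)⁻¹ := by
  show (if (1 : Fin 3) = 0 then _ else _) = _
  rw [if_neg (by decide), if_pos rfl]

/-- The composite level has constant 2·D₁n₁/c_min² + 2·n₁·D n/c_min². [folklore] -/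
theorem lvlP3_two (cmin : ℝ) (D₁ n₁ D n : ℕ) :
    lvlP3 cmin D₁ n₁ D n 2 =
      2 * ((D₁ : ℝ) * n₁ * (cmin ^ 2)⁻¹) + 2 * n₁ * ((D : ℝ) * n * (cmin ^ 2)⁻¹) := by
  show (if (2 : Fin 3) = 0 then _ else _) = _
  rw [if_neg (by decide), if_neg (by decide)]

/-- The level constants are ≥ 0. [folklore] -/
theorem lvlP3_nonneg (cmin : ℝ) (D₁ n₁ D n : ℕ) (l : Fin 3) : 0 ≤ lvlP3 cmin D₁ n₁ D n l := by
  have hP1 : 0 ≤ (D₁ : ℝ) * n₁ * (cmin ^ 2)⁻¹ := by positivity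
  have hPK : 0 ≤ (D : ℝ) * n * (cmin ^ 2)⁻¹ := by positivity
  unfold lvlP3
  split_ifs <;> positivity

/-- The sum of the three level constants is 3·D₁n₁/c_min² + 2·n₁·D n/c_min². [folklore] -/
theorem sum_lvlP3 (cmin : ℝ) (D₁ n₁ D n : ℕ) :
    ∑ l, lvlP3 cmin D₁ n₁ D n l =
      3 * ((D₁ : ℝ) * n₁ * (cmin ^ 2)⁻¹) + 2 * n₁ * ((D : ℝ) * n * (cmin ^ 2)⁻¹) := by
  rw [Fin.sum_univ_three, lvlP3_zero, lvlP3_one, lvlP3_two]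
  ring

/-- MODEL bookkeeping: **the coercivity constant with all three levels**,
σ₃ = ((a_min w_min²)⁻¹ + 3·D₁n₁/c_min² + 2·n₁·D n/c_min²)⁻¹. [folklore] -/
def sigma3 (amin wmin cmin : ℝ) (D₁ n₁ D n : ℕ) : ℝ :=
  ((amin * wmin ^ 2)⁻¹ + (3 * ((D₁ : ℝ) * n₁ * (cmin ^ 2)⁻¹) + 2 * n₁ * ((D : ℝ) * n * (cmin ^ 2)⁻¹)))⁻¹

/-- σ₃ is the `sigmaL` of `B9Thm37GlueTorusCovLevelsPoinc` at the summed constants. [folklore] -/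
theorem sigmaL_lvlP3 (amin wmin cmin : ℝ) (D₁ n₁ D n : ℕ) :
    sigmaL amin wmin (∑ l, lvlP3 cmin D₁ n₁ D n l) = sigma3 amin wmin cmin D₁ n₁ D n := by
  rw [sum_lvlP3]
  rfl

/-- σ₃ > 0 for a_min, w_min > 0. [folklore] -/
theorem sigma3_pos {amin wmin : ℝ} (cmin : ℝ) (D₁ n₁ D n : ℕ) (hamin : 0 < amin) (hwmin : 0 < wmin) :
    0 < sigma3 amin wmin cmin D₁ n₁ D n := by
  rw [← sigmaL_lvlP3]
  exact sigmaL_pos hamin hwmin (Finset.sum_nonneg fun l _ => lvlP3_nonneg cmin D₁ n₁ D n l)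

/-- σ₃ ≤ σ of `B9Thm37GlueTorusCovPoinc` (the all-levels constant is the weaker one; it buys the larger cover).
[folklore] -/
theorem sigma3_le_sigma {amin wmin : ℝ} (cmin : ℝ) (D₁ n₁ D n : ℕ) (hamin : 0 < amin) (hwmin : 0 < wmin) :
    sigma3 amin wmin cmin D₁ n₁ D n ≤ sigma amin wmin cmin D₁ n₁ := by
  have hA : 0 < (amin * wmin ^ 2)⁻¹ := inv_pos.mpr (mul_pos hamin (pow_pos hwmin 2))
  have hP1 : 0 ≤ (D₁ : ℝ) * n₁ * (cmin ^ 2)⁻¹ := by positivity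
  have hPK : 0 ≤ (n₁ : ℝ) * ((D : ℝ) * n * (cmin ^ 2)⁻¹) := by positivity
  unfold sigma3 sigma
  exact inv_anti₀ (by positivity) (by nlinarith)

/-- The deviation bounds of ALL THREE levels of the family (identity: 0; fine comb: `sum_dev_sq_le`; composite:
`lvl_two_dev_sq_le`). [folklore] -/
theorem lvl3_dev_sq_le (hRm : ∀ b i j, ∑ k, Rm b k i * Rm b k j = if i = j then (1 : ℝ) else 0)
    {c : Bd → ℝ} {cmin : ℝ} (hcmin : 0 < cmin) (hc : ∀ b, cmin ≤ |c b|) {D₁ : ℕ} (hD₁ : ∀ x, K₁.depth x ≤ D₁)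
    {n₁ : ℕ} (hn₁ : ∀ β, (univ.filter fun x => K₁.blk x = β).card ≤ n₁) {D : ℕ} (hD : ∀ x, K.depth x ≤ D)
    {n : ℕ} (hn : ∀ β, (univ.filter fun x => K.blk x = β).card ≤ n) :
    ∀ l ∈ (univ : Finset (Fin 3)), ∀ f : St × Cp → ℝ,
      ∑ x, ∑ i, gdev (lvlBlk K₁ K l) (lvlTr K₁ K Rm l) (fun y => y) f x i ^ 2 ≤
        lvlP3 cmin D₁ n₁ D n l * ∑ b, covD src tgt c Rm f b ^ 2 := by
  intro l _ f
  have h3 : l = 0 ∨ l = 1 ∨ l = 2 := by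
    fin_cases l
    · exact Or.inl rfl
    · exact Or.inr (Or.inl rfl)
    · exact Or.inr (Or.inr rfl)
  rcases h3 with rfl | rfl | rfl
  · rw [lvlP3_zero, zero_mul]
    simp only [gdev_lvl_zero]
    simp
  · rw [lvlP3_one]
    simp only [gdev_lvl_one]
    exact sum_dev_sq_le K₁ c Rm hRm hcmin hc hD₁ hn₁ f
  · rw [lvlP3_two]
    exact lvl_two_dev_sq_le K₁ K Rm hRm hcmin hc hD₁ hn₁ hD hn f

/-- **COERCIVITY OF THE THREE-LEVEL OPERATOR Δ_U + a₀·M_{W₀}ᵀM_{W₀} + a₁·Q₁ᵀQ₁ + a₂·(Q₂Q₁)ᵀ(Q₂Q₁) WITH THE COVER OVER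
ALL THREE LEVELS, UNIFORM IN THE TRANSPORT** (block weights W_l = w_l ∘ lvlBlk_l; all a_l ≥ 0).  If every site x of
the support of f has SOME level l ∈ {0, 1, 2} with a_l ≥ a_min and |w_l(lvlBlk_l x)| ≥ w_min — in particular a site
of the level-2 region alone — then σ₃·Σ_p f(p)² ≤ Σ_p f(p)(… f)(p), σ₃ = `sigma3 a_min w_min c_min D₁ n₁ D n`.
[cite: Balaban1985BackgroundPropagators, (3.16) p.393 + (3.23)–(3.24) p.394 + p.395] -/
theorem coercive_threeLevelOp_all (hRm : ∀ b i j, ∑ k, Rm b k i * Rm b k j = if i = j then (1 : ℝ) else 0)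
    {c : Bd → ℝ} {cmin : ℝ} (hcmin : 0 < cmin) (hc : ∀ b, cmin ≤ |c b|) {D₁ : ℕ} (hD₁ : ∀ x, K₁.depth x ≤ D₁)
    {n₁ : ℕ} (hn₁ : ∀ β, (univ.filter fun x => K₁.blk x = β).card ≤ n₁) {D : ℕ} (hD : ∀ x, K.depth x ≤ D)
    {n : ℕ} (hn : ∀ β, (univ.filter fun x => K.blk x = β).card ≤ n) (w : Fin 3 → St → ℝ) {a : Fin 3 → ℝ}
    (ha : ∀ l, 0 ≤ a l) {amin wmin : ℝ} (hamin : 0 < amin) (hwmin : 0 < wmin) (f : St × Cp → ℝ)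
    (hcov : ∀ x i, f (x, i) ≠ 0 → ∃ l, amin ≤ a l ∧ wmin ≤ |w l (lvlBlk K₁ K l x)|) :
    sigma3 amin wmin cmin D₁ n₁ D n * ∑ p, f p ^ 2 ≤
      ∑ p, f p * threeLevelOp K₁ K Rm c (fun l x => w l (lvlBlk K₁ K l x)) a f p := by
  rw [← sigmaL_lvlP3 amin wmin cmin D₁ n₁ D n]
  exact coercive_levelOp src tgt c Rm (lvlBlk K₁ K) w (lvlTr K₁ K Rm) (fun _ y => y) a univ
    (fun l _ => lvlTr_orth K₁ K Rm hRm l) ha (fun l _ => lvlP3_nonneg cmin D₁ n₁ D n l)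
    (lvl3_dev_sq_le K₁ K Rm hRm hcmin hc hD₁ hn₁ hD hn) hamin hwmin f
    fun x i h => by obtain ⟨l, hl⟩ := hcov x i h; exact ⟨l, mem_univ _, hl⟩

/-- **ℓ² bound of the inverse of the three-level operator, uniform in the transport**, when the three levels
cover all sites: Σ_p ((…)⁻¹g)(p)² ≤ σ₃⁻²·Σ_p g(p)². [folklore] -/
theorem inverse_sq_le_threeLevelOp_all (hRm : ∀ b i j, ∑ k, Rm b k i * Rm b k j = if i = j then (1 : ℝ) else 0)
    {c : Bd → ℝ} {cmin : ℝ} (hcmin : 0 < cmin) (hc : ∀ b, cmin ≤ |c b|) {D₁ : ℕ} (hD₁ : ∀ x, K₁.depth x ≤ D₁)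
    {n₁ : ℕ} (hn₁ : ∀ β, (univ.filter fun x => K₁.blk x = β).card ≤ n₁) {D : ℕ} (hD : ∀ x, K.depth x ≤ D)
    {n : ℕ} (hn : ∀ β, (univ.filter fun x => K.blk x = β).card ≤ n) (w : Fin 3 → St → ℝ) {a : Fin 3 → ℝ}
    (ha : ∀ l, 0 ≤ a l) {amin wmin : ℝ} (hamin : 0 < amin) (hwmin : 0 < wmin)
    (hcov : ∀ x, ∃ l, amin ≤ a l ∧ wmin ≤ |w l (lvlBlk K₁ K l x)|) (g : St × Cp → ℝ) :
    ∑ p, (Ring.inverse (threeLevelOp K₁ K Rm c (fun l x => w l (lvlBlk K₁ K l x)) a) g) p ^ 2 ≤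
      (sigma3 amin wmin cmin D₁ n₁ D n ^ 2)⁻¹ * ∑ p, g p ^ 2 := by
  rw [← sigmaL_lvlP3 amin wmin cmin D₁ n₁ D n]
  exact inverse_sq_le_levelOp src tgt c Rm (lvlBlk K₁ K) w (lvlTr K₁ K Rm) (fun _ y => y) a univ
    (fun l _ => lvlTr_orth K₁ K Rm hRm l) ha (fun l _ => lvlP3_nonneg cmin D₁ n₁ D n l)
    (lvl3_dev_sq_le K₁ K Rm hRm hcmin hc hD₁ hn₁ hD hn) hamin hwmin
    (fun x => by obtain ⟨l, hl⟩ := hcov x; exact ⟨l, mem_univ _, hl⟩) g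

/-- **ℓ² bound of the DIRICHLET INVERSE of the three-level operator on Ω₀ = {χ = 1}, uniform in the transport**,
when the three levels cover Ω₀ (χ {0,1}-valued): Σ_p (G′g)(p)² ≤ σ₃⁻²·Σ_p g(p)².
[cite: Balaban1985BackgroundPropagators, (3.16) p.393 + p.394 + p.395] -/
theorem threeLevelDir_sq_le_all (hRm : ∀ b i j, ∑ k, Rm b k i * Rm b k j = if i = j then (1 : ℝ) else 0)
    {c : Bd → ℝ} {cmin : ℝ} (hcmin : 0 < cmin) (hc : ∀ b, cmin ≤ |c b|) {D₁ : ℕ} (hD₁ : ∀ x, K₁.depth x ≤ D₁)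
    {n₁ : ℕ} (hn₁ : ∀ β, (univ.filter fun x => K₁.blk x = β).card ≤ n₁) {D : ℕ} (hD : ∀ x, K.depth x ≤ D)
    {n : ℕ} (hn : ∀ β, (univ.filter fun x => K.blk x = β).card ≤ n) (w : Fin 3 → St → ℝ) {a : Fin 3 → ℝ}
    (ha : ∀ l, 0 ≤ a l) {amin wmin : ℝ} (hamin : 0 < amin) (hwmin : 0 < wmin) {χ : St × Cp → ℝ}
    (hχ : ∀ p, χ p = 0 ∨ χ p = 1)
    (hcov : ∀ x i, χ (x, i) = 1 → ∃ l, amin ≤ a l ∧ wmin ≤ |w l (lvlBlk K₁ K l x)|) (g : St × Cp → ℝ) :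
    ∑ p, (dirInv (threeLevelOp K₁ K Rm c (fun l x => w l (lvlBlk K₁ K l x)) a) χ g) p ^ 2 ≤
      (sigma3 amin wmin cmin D₁ n₁ D n ^ 2)⁻¹ * ∑ p, g p ^ 2 := by
  rw [← sigmaL_lvlP3 amin wmin cmin D₁ n₁ D n]
  exact levelDir_sq_le src tgt c Rm (lvlBlk K₁ K) w (lvlTr K₁ K Rm) (fun _ y => y) a univ
    (fun l _ => lvlTr_orth K₁ K Rm hRm l) ha (fun l _ => lvlP3_nonneg cmin D₁ n₁ D n l)
    (lvl3_dev_sq_le K₁ K Rm hRm hcmin hc hD₁ hn₁ hD hn) hamin hwmin hχ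
    (fun x i h => by obtain ⟨l, hl⟩ := hcov x i h; exact ⟨l, mem_univ _, hl⟩) g

end ThreeLevels

/-! ## §4  The torus: cube combs of sides M₀ (fine) and M (coarse) -/

section Torus

variable {d : ℕ} {N : Fin d → ℕ} [∀ i, NeZero (N i)] [NeZero d]

/-- MODEL bookkeeping: **the all-levels coercivity constant on the torus**,
σ₃(d, M₀, M, a_min, w_min, c_min) = `sigma3 a_min w_min c_min (d(M₀−1)) (M₀^d) (d(M−1)) (M^d)` — independent of
the volume N and of the transport. [folklore] -/
def sigmaTorus3 (d M₀ M : ℕ) (amin wmin cmin : ℝ) : ℝ :=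
  sigma3 amin wmin cmin (d * (M₀ - 1)) (M₀ ^ d) (d * (M - 1)) (M ^ d)

/-- σ₃ > 0 on the torus. [folklore] -/
theorem sigmaTorus3_pos (d M₀ M : ℕ) {amin wmin : ℝ} (cmin : ℝ) (hamin : 0 < amin) (hwmin : 0 < wmin) :
    0 < sigmaTorus3 d M₀ M amin wmin cmin :=
  sigma3_pos cmin _ _ _ _ hamin hwmin

/-- **COERCIVITY OF THE THREE-LEVEL OPERATOR ON THE TORUS WITH THE COVER OVER ALL THREE LEVELS, UNIFORM IN THE
VOLUME AND THE TRANSPORT**: σ₃(d, M₀, M, a_min, w_min, c_min)·Σ_p f(p)² ≤ Σ_p f(p)(… f)(p).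
[cite: Balaban1985BackgroundPropagators, (3.16) p.393 + (3.23)–(3.24) p.394 + p.395] -/
theorem coercive_threeLevelOp_all_torus {Cp : Type} [Fintype Cp] [DecidableEq Cp] {M₀ M : ℕ} (hM₀ : 1 ≤ M₀)
    (hdiv₀ : ∀ i, M₀ ∣ N i) (hM : 1 ≤ M) (hdiv : ∀ i, M ∣ N i) {Rm : UT N × Fin d → Cp → Cp → ℝ}
    (hRm : ∀ b i j, ∑ k, Rm b k i * Rm b k j = if i = j then (1 : ℝ) else 0) {c : UT N × Fin d → ℝ}
    {cmin : ℝ} (hcmin : 0 < cmin) (hc : ∀ b, cmin ≤ |c b|) (w : Fin 3 → UT N → ℝ) {a : Fin 3 → ℝ}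
    (ha : ∀ l, 0 ≤ a l) {amin wmin : ℝ} (hamin : 0 < amin) (hwmin : 0 < wmin) (f : UT N × Cp → ℝ)
    (hcov : ∀ x i, f (x, i) ≠ 0 → ∃ l, amin ≤ a l ∧
      wmin ≤ |w l (lvlBlk (torusComb hM₀ hdiv₀) (torusComb hM hdiv) l x)|) :
    sigmaTorus3 d M₀ M amin wmin cmin * ∑ p, f p ^ 2 ≤
      ∑ p, f p * threeLevelOp (torusComb hM₀ hdiv₀) (torusComb hM hdiv) Rm c
        (fun l x => w l (lvlBlk (torusComb hM₀ hdiv₀) (torusComb hM hdiv) l x)) a f p :=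
  coercive_threeLevelOp_all (torusComb hM₀ hdiv₀) (torusComb hM hdiv) Rm hRm hcmin hc (fun x => tdepth_le hM₀ x)
    (fun z => card_block_le hM₀ hdiv₀ z) (fun x => tdepth_le hM x) (fun z => card_block_le hM hdiv z) w ha hamin
    hwmin f hcov

/-- **ℓ² bound of the inverse of the three-level operator on the torus, uniform in the volume and the transport**,
the three levels covering all sites: Σ_p ((…)⁻¹g)(p)² ≤ σ₃⁻²·Σ_p g(p)². [folklore] -/
theorem inverse_sq_le_threeLevelOp_all_torus {Cp : Type} [Fintype Cp] [DecidableEq Cp] {M₀ M : ℕ}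
    (hM₀ : 1 ≤ M₀) (hdiv₀ : ∀ i, M₀ ∣ N i) (hM : 1 ≤ M) (hdiv : ∀ i, M ∣ N i)
    {Rm : UT N × Fin d → Cp → Cp → ℝ}
    (hRm : ∀ b i j, ∑ k, Rm b k i * Rm b k j = if i = j then (1 : ℝ) else 0) {c : UT N × Fin d → ℝ}
    {cmin : ℝ} (hcmin : 0 < cmin) (hc : ∀ b, cmin ≤ |c b|) (w : Fin 3 → UT N → ℝ) {a : Fin 3 → ℝ}
    (ha : ∀ l, 0 ≤ a l) {amin wmin : ℝ} (hamin : 0 < amin) (hwmin : 0 < wmin)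
    (hcov : ∀ x, ∃ l, amin ≤ a l ∧ wmin ≤ |w l (lvlBlk (torusComb hM₀ hdiv₀) (torusComb hM hdiv) l x)|)
    (g : UT N × Cp → ℝ) :
    ∑ p, (Ring.inverse (threeLevelOp (torusComb hM₀ hdiv₀) (torusComb hM hdiv) Rm c
        (fun l x => w l (lvlBlk (torusComb hM₀ hdiv₀) (torusComb hM hdiv) l x)) a) g) p ^ 2 ≤
      (sigmaTorus3 d M₀ M amin wmin cmin ^ 2)⁻¹ * ∑ p, g p ^ 2 :=
  inverse_sq_le_threeLevelOp_all (torusComb hM₀ hdiv₀) (torusComb hM hdiv) Rm hRm hcmin hc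
    (fun x => tdepth_le hM₀ x) (fun z => card_block_le hM₀ hdiv₀ z) (fun x => tdepth_le hM x)
    (fun z => card_block_le hM hdiv z) w ha hamin hwmin hcov g

/-- **ℓ² bound of the DIRICHLET INVERSE of the three-level operator on the torus region Ω₀ = {χ = 1}, uniform in
the volume and the transport**, the three levels covering Ω₀: Σ_p (G′g)(p)² ≤ σ₃⁻²·Σ_p g(p)².
[cite: Balaban1985BackgroundPropagators, (3.16) p.393 + p.394 + p.395] -/
theorem threeLevelDir_sq_le_all_torus {Cp : Type} [Fintype Cp] [DecidableEq Cp] {M₀ M : ℕ} (hM₀ : 1 ≤ M₀)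
    (hdiv₀ : ∀ i, M₀ ∣ N i) (hM : 1 ≤ M) (hdiv : ∀ i, M ∣ N i) {Rm : UT N × Fin d → Cp → Cp → ℝ}
    (hRm : ∀ b i j, ∑ k, Rm b k i * Rm b k j = if i = j then (1 : ℝ) else 0) {c : UT N × Fin d → ℝ}
    {cmin : ℝ} (hcmin : 0 < cmin) (hc : ∀ b, cmin ≤ |c b|) (w : Fin 3 → UT N → ℝ) {a : Fin 3 → ℝ}
    (ha : ∀ l, 0 ≤ a l) {amin wmin : ℝ} (hamin : 0 < amin) (hwmin : 0 < wmin) {χ : UT N × Cp → ℝ}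
    (hχ : ∀ p, χ p = 0 ∨ χ p = 1)
    (hcov : ∀ x i, χ (x, i) = 1 → ∃ l, amin ≤ a l ∧
      wmin ≤ |w l (lvlBlk (torusComb hM₀ hdiv₀) (torusComb hM hdiv) l x)|) (g : UT N × Cp → ℝ) :
    ∑ p, (dirInv (threeLevelOp (torusComb hM₀ hdiv₀) (torusComb hM hdiv) Rm c
        (fun l x => w l (lvlBlk (torusComb hM₀ hdiv₀) (torusComb hM hdiv) l x)) a) χ g) p ^ 2 ≤
      (sigmaTorus3 d M₀ M amin wmin cmin ^ 2)⁻¹ * ∑ p, g p ^ 2 :=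
  threeLevelDir_sq_le_all (torusComb hM₀ hdiv₀) (torusComb hM hdiv) Rm hRm hcmin hc (fun x => tdepth_le hM₀ x)
    (fun z => card_block_le hM₀ hdiv₀ z) (fun x => tdepth_le hM x) (fun z => card_block_le hM hdiv z) w ha hamin
    hwmin hχ hcov g

end Torus

end

end Literature.MathematicalPhysics.QuantumFieldTheory.Balaban1983to89.B9Thm37GlueTorusCovLevelsTower
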